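import Summits.BirchSwinnertonDyer.BirchSwinnertonDyer.Theorems.AlignedTransportAtTwoMainConjectureOfRankZeroBSDAtTwoCubicDoorsDeadSubcellClassNumberE
import Summits.BirchSwinnertonDyer.Rank1Residual.X5.TwoAdicInstancesToolkitB
import Literature.NumberTheory.CubicFields.CubicFieldDiscriminant4087ClassNumber
import Summits.BirchSwinnertonDyer.BirchSwinnertonDyer.Theorems.AlignedTransportAtTwoMainConjectureOfRankZeroBSDAtTwoTwistSaturationRow4087
import HarnessLib

/-!
# Route `AlignedTransportAtTwo`, crux C2 `MainConjectureOfRankZeroBSDAtTwo` (stmt-BirchSwinnertonDyer-22298):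
# THE SPLIT-STRATUM SEED `[1, 1, 0, -4, 3]` (`N = 4087`): kernel-decided invariants, `Δ_min = -4087 = −4087·1² ≡ 1 (mod 8)` (ON the Kilford stratum),
# and its cubic `2`-torsion field `ℚ(β)` = the cubic field of discriminant `−4087` (`h = 1`, `2` totally split — Dedekind-type, no power integral basis; regulator `≈ 32.4`)

HONEST FRAMING (cell `bsd-f1-sign2`, WIDTH-5 attached prover seat `bsd-line-att-p4` gen 47 on line `birth` of the lead `bsd-line-att-p2`;
`--supports` stmt-BirchSwinnertonDyer-22298, closes nothing; BSD is NOT proved by any of this; the crux C2, its verdict «blocked-on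
`Rank1Residual.GreenbergMuConjectureIrreducible`» and every registered stub are untouched).  THEOREMS ONLY; the curve is written LITERALLY; no Cremona label is asserted.

WHAT.  The W-data row (template: att-p4 g46's `…CubicSplitStratumSeedN21765` / `…SeedN17671`) for a seed of the SPLIT stratum `Δ_min ≡ 1 (mod 8)` of the cell's census (att-p3 g53
`CENSUS-SPLITDOOR-att-p3-g53.md`, `r = 1`) whose cubic field was left UNDECIDED by g46 («units e^32 / e^60: random-weight LLL too weak»); the cubic `2`-torsion field is the
Dedekind-type field of discriminant `−4087` (this seat's `CubicFieldDiscriminant4087{,Primes,ClassNumber}` resp. `{,ClassNumber}`: `𝓞 = ℤ ⊕ ℤθ ⊕ ℤδ`, `θ³ − 7θ² + 18θ + 8 = 0`, `δ = (θ² + θ)/2`, `h = 1`).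
Here (the model invariants of `⟨1, 1, 0, −4, 3⟩` are att-p5 g46's `…TwistSaturationRow4087`, IMPORTED and REUSED, not restated): `Δ = -4087`, `c₄ = 217` (coprime ⟹ globally minimal), `#Ẽ(𝔽₂) = 2` (good ORDINARY at `2`), `b₂,b₄,b₆ = 5, -8, 12`, `E[2]` irreducible (the `u`-cubic has no
root mod `7`), `Δ_min ≡ 1 (mod 8)`, `Δ < 0`, ★ `aeval_theta_n4087bis` (`θ = g² + (13/4)g + (1/2)` is a root of `X³ − 7X² + 18X + 8`), `finrank`, `discr = −4087`,
★ `classNumber_cubicField_n4087bis_eq_one`, ★ `not_two_dvd_classNumber_cubicField_n4087bis`.  Consumed by this seat's general layer-two relation row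
`…CubicSplitStratumLayerTwoGeneralRelationRowN4087bis` (LINEAR shape `c³·σc = 1`, `λ₂ ≤ 1`).  Nothing is asserted about `μ₂` or `MC₂` here.

References: [LMFDB] number field 3.1.4087.1, elliptic curves of conductor 4087; [Marcus2018] Ch. 3 Ex. 21, Ch. 5 Thm. 37; [SilvermanAEC2009] III.1, III.2.3, VII.1,
VII.5; [Serre1973] II §3.3; tree: att-p4 g46's `…CubicSplitStratumSeedN17671` (template), this seat's `CubicFieldDiscriminant4087`.
-/

set_option linter.dupNamespace false
set_option autoImplicit false

noncomputable section

open scoped Classical NumberField nonZeroDivisors IntermediateField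

namespace Summit.BirchSwinnertonDyer.BirchSwinnertonDyer.Theorems.AlignedTransportAtTwoCubicSplitStratumSeedN4087bis

open NumberField IsDedekindDomain Polynomial WeierstrassCurve IntermediateField CongruenceSubgroup Module
  Literature.NumberTheory.IwasawaTheory Literature.NumberTheory.GaloisRepresentations
  Literature.NumberTheory.EllipticCurves Literature.NumberTheory.EllipticCurves.Greenberg1999
  Literature.NumberTheory.EllipticCurves.ModularForms Literature.NumberTheory.EllipticCurves.Rank1Residual
  Literature.NumberTheory.EllipticCurves.Module
  Literature.NumberTheory.NumberFields Literature.NumberTheory.CubicFields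
  Summit.BirchSwinnertonDyer.Rank1Residual Summit.BirchSwinnertonDyer.Rank1Residual.X1.MuLambda
  Summit.BirchSwinnertonDyer.Rank1Residual.X5 Summit.BirchSwinnertonDyer.Rank1Residual.X5.O1
  Summit.BirchSwinnertonDyer.Rank1Residual.X5.Instances Summit.BirchSwinnertonDyer.Rank1Residual.F1Sign2
  Summit.BirchSwinnertonDyer.BirchSwinnertonDyer.Theorems.Rank1ResidualX1Defs
  Summit.BirchSwinnertonDyer.BirchSwinnertonDyer.Theses.AlignedTransportAtTwo
  Summit.BirchSwinnertonDyer.BirchSwinnertonDyer.Theorems.AlignedTransportAtTwoKilfordStratumShared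
open Summit.BirchSwinnertonDyer.BirchSwinnertonDyer.Theorems.AlignedTransportAtTwoCubicKilfordPrimes (psi_gen_eq_zero)
open Summit.BirchSwinnertonDyer.BirchSwinnertonDyer.Theorems.AlignedTransportAtTwoTwistSaturationRow4087
  (M4087_Δ M4087_c₄ isElliptic_4087 isGloballyMinimal_4087 M4087_mod_two M4087_card_two goodOrd_two_4087 c4087_eq c4087_b irr_two_4087 not_hasRationalTwoTorsionX_4087)

/-! ## §0 The curve `⟨1, 1, 0, -4, 3⟩` of conductor `4087` (rank 0; the second seed of this conductor, tag `4087bis`) — its cubic field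

The model invariants `Δ`, `c₄`, ellipticity, global minimality, the reduction mod `2` (`#Ẽ(𝔽₂) = 2`, good ordinary), `b₂,b₄,b₆`, `E[2]` irreducible and the
`ht` binder are att-p5 g46's `…TwistSaturationRow4087` (REUSED, not restated: `M4087_Δ`, `M4087_c₄`, `isElliptic_4087`, `isGloballyMinimal_4087`, `M4087_mod_two`,
`M4087_card_two`, `goodOrd_two_4087`, `c4087_eq`, `c4087_b`, `irr_two_4087`, `not_hasRationalTwoTorsionX_4087`). -/

/-- `Δ_min = -4087`. [cite: SilvermanAEC2009, VII.1] -/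
theorem minimalDiscriminantInt_n4087bis [((⟨1, 1, 0, -4, 3⟩ : WeierstrassCurve ℤ).baseChange ℚ).IsGloballyMinimal] : ((⟨1, 1, 0, -4, 3⟩ : WeierstrassCurve ℤ).baseChange ℚ).minimalDiscriminantInt = -4087 := by
  rw [Instances.minimalDiscriminantInt_baseChange_int, M4087_Δ]

/-- `Δ_min = -4087 ≡ 1 (mod 8)`: ON the Kilford (split) stratum — `2` splits completely in `ℚ(β)`. [cite: Serre1973, Ch. II §3.3 Thm. 4] -/
theorem minimalDiscriminantInt_emod_eight_n4087bis [((⟨1, 1, 0, -4, 3⟩ : WeierstrassCurve ℤ).baseChange ℚ).IsGloballyMinimal] : ((⟨1, 1, 0, -4, 3⟩ : WeierstrassCurve ℤ).baseChange ℚ).minimalDiscriminantInt % 8 = 1 := by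
  rw [minimalDiscriminantInt_n4087bis]; decide

/-- **`⟨1, 1, 0, -4, 3⟩` is ON the Kilford stratum.** [cite: Serre1973, Ch. II §3.3 Thm. 4] -/
theorem onKilfordStratumAtTwo_n4087bis [((⟨1, 1, 0, -4, 3⟩ : WeierstrassCurve ℤ).baseChange ℚ).IsElliptic] [((⟨1, 1, 0, -4, 3⟩ : WeierstrassCurve ℤ).baseChange ℚ).IsGloballyMinimal] : OnKilfordStratumAtTwo ((⟨1, 1, 0, -4, 3⟩ : WeierstrassCurve ℤ).baseChange ℚ) :=
  (onKilfordStratumAtTwo_iff_minimalDiscriminantInt_emod_eight _ goodOrd_two_4087).mpr minimalDiscriminantInt_emod_eight_n4087bis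

/-- `Δ < 0` (`ℚ(β)` is a complex cubic field). [cite: SilvermanAEC2009, III.1] -/
theorem Δ_n4087bis_neg : ((⟨1, 1, 0, -4, 3⟩ : WeierstrassCurve ℤ).baseChange ℚ).Δ < 0 := by
  rw [baseChange_int_Δ, M4087_Δ]; norm_num

/-- **`θ := g² + (13/4)g + (1/2) ∈ ℚ(β)` (`g = β`) is a root of `f = X³ − 7X² + 18X + 8`** (one `linear_combination` against `ψ_W(β) = 4β³ + 5β² + 2·(-8)β + (12) = 0`;
the multiplier is the exact quotient in `ℚ[β]`). [cite: LMFDB, number field 3.1.4087.1 (degree 3, discriminant −4087)] [cite: SilvermanAEC2009, III.1] -/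
theorem aeval_theta_n4087bis {β : AlgebraicClosure ℚ} (hβ : aeval β ((⟨1, 1, 0, -4, 3⟩ : WeierstrassCurve ℤ).baseChange ℚ).twoTorsionPolynomial.toPoly = 0) :
    aeval ((1 : ↥(IntermediateField.adjoin ℚ ({β} : Set (AlgebraicClosure ℚ)))) * (AdjoinSimple.gen ℚ β : ↥(IntermediateField.adjoin ℚ ({β} : Set (AlgebraicClosure ℚ)))) ^ 2 + (13 / 4 : ↥(IntermediateField.adjoin ℚ ({β} : Set (AlgebraicClosure ℚ)))) * (AdjoinSimple.gen ℚ β : ↥(IntermediateField.adjoin ℚ ({β} : Set (AlgebraicClosure ℚ)))) + (1 / 2 : ↥(IntermediateField.adjoin ℚ ({β} : Set (AlgebraicClosure ℚ))))) (MonicCubic.poly (-7) 18 8) = 0 := by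
  have hψ := psi_gen_eq_zero ((⟨1, 1, 0, -4, 3⟩ : WeierstrassCurve ℤ).baseChange ℚ) hβ
  rw [c4087_b.1, c4087_b.2.1, c4087_b.2.2] at hψ
  set g : ↥(IntermediateField.adjoin ℚ ({β} : Set (AlgebraicClosure ℚ))) := AdjoinSimple.gen ℚ β with hg
  simp only [MonicCubic.poly, map_add, map_mul, map_pow, aeval_X, eq_intCast, map_intCast]
  push_cast at hψ ⊢
  linear_combination ((41 / 32 : ↥(IntermediateField.adjoin ℚ ({β} : Set (AlgebraicClosure ℚ)))) * g ^ 0 + (313 / 64 : ↥(IntermediateField.adjoin ℚ ({β} : Set (AlgebraicClosure ℚ)))) * g ^ 1 + (17 / 8 : ↥(IntermediateField.adjoin ℚ ({β} : Set (AlgebraicClosure ℚ)))) * g ^ 2 + (1 / 4 : ↥(IntermediateField.adjoin ℚ ({β} : Set (AlgebraicClosure ℚ)))) * g ^ 3) * hψ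

/-- `[ℚ(β) : ℚ] = 3`. [cite: SilvermanAEC2009, III.2.3 (b)] -/
theorem finrank_cubicField_n4087bis {β : AlgebraicClosure ℚ} (hβ : aeval β ((⟨1, 1, 0, -4, 3⟩ : WeierstrassCurve ℤ).baseChange ℚ).twoTorsionPolynomial.toPoly = 0) :
    finrank ℚ ↥(IntermediateField.adjoin ℚ ({β} : Set (AlgebraicClosure ℚ))) = 3 := by
  haveI := isElliptic_4087
  exact AddKatoTwo.finrank_adjoin_root_twoTorsionPolynomial_eq_three _
    (AlignedTransportAtTwoSeed.irr_two_of_forall_not_hasRationalTwoTorsionX _ not_hasRationalTwoTorsionX_4087) hβ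

/-- **`d_{ℚ(β)} = −4087`**. [cite: LMFDB, number field 3.1.4087.1 (discriminant −4087)] -/
theorem discr_cubicField_n4087bis {β : AlgebraicClosure ℚ} (hβ : aeval β ((⟨1, 1, 0, -4, 3⟩ : WeierstrassCurve ℤ).baseChange ℚ).twoTorsionPolynomial.toPoly = 0) :
    (haveI : FiniteDimensional ℚ ↥(IntermediateField.adjoin ℚ ({β} : Set (AlgebraicClosure ℚ))) := IntermediateField.adjoin.finiteDimensional ((AlgebraicClosure.isAlgebraic ℚ).isAlgebraic β).isIntegral;
      haveI : NumberField ↥(IntermediateField.adjoin ℚ ({β} : Set (AlgebraicClosure ℚ))) := NumberField.mk;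
      NumberField.discr ↥(IntermediateField.adjoin ℚ ({β} : Set (AlgebraicClosure ℚ))) = -4087) := by
  haveI : FiniteDimensional ℚ ↥(IntermediateField.adjoin ℚ ({β} : Set (AlgebraicClosure ℚ))) := IntermediateField.adjoin.finiteDimensional ((AlgebraicClosure.isAlgebraic ℚ).isAlgebraic β).isIntegral
  haveI : NumberField ↥(IntermediateField.adjoin ℚ ({β} : Set (AlgebraicClosure ℚ))) := NumberField.mk
  exact CubicDisc4087.discr_eq (finrank_cubicField_n4087bis hβ) (aeval_theta_n4087bis hβ)

/-- ★ **`h(ℚ(β)) = 1`** (`ℚ(β)` = the cubic field of discriminant `−4087`, this seat's `CubicDisc4087.classNumber_eq_one`). [cite: LMFDB, number field 3.1.4087.1 (class number 1)] -/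
theorem classNumber_cubicField_n4087bis_eq_one {β : AlgebraicClosure ℚ} (hβ : aeval β ((⟨1, 1, 0, -4, 3⟩ : WeierstrassCurve ℤ).baseChange ℚ).twoTorsionPolynomial.toPoly = 0) :
    (haveI : FiniteDimensional ℚ ↥(IntermediateField.adjoin ℚ ({β} : Set (AlgebraicClosure ℚ))) := IntermediateField.adjoin.finiteDimensional ((AlgebraicClosure.isAlgebraic ℚ).isAlgebraic β).isIntegral;
      haveI : NumberField ↥(IntermediateField.adjoin ℚ ({β} : Set (AlgebraicClosure ℚ))) := NumberField.mk;
      classNumber ↥(IntermediateField.adjoin ℚ ({β} : Set (AlgebraicClosure ℚ))) = 1) := by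
  haveI : FiniteDimensional ℚ ↥(IntermediateField.adjoin ℚ ({β} : Set (AlgebraicClosure ℚ))) := IntermediateField.adjoin.finiteDimensional ((AlgebraicClosure.isAlgebraic ℚ).isAlgebraic β).isIntegral
  haveI : NumberField ↥(IntermediateField.adjoin ℚ ({β} : Set (AlgebraicClosure ℚ))) := NumberField.mk
  exact CubicDisc4087.classNumber_eq_one (finrank_cubicField_n4087bis hβ) (aeval_theta_n4087bis hβ)

/-- ★ **`2 ∤ h(ℚ(β))`** (the doors' datum verbatim). [cite: LMFDB, number field 3.1.4087.1 (class number 1)] -/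
theorem not_two_dvd_classNumber_cubicField_n4087bis {β : AlgebraicClosure ℚ} (hβ : aeval β ((⟨1, 1, 0, -4, 3⟩ : WeierstrassCurve ℤ).baseChange ℚ).twoTorsionPolynomial.toPoly = 0) :
    (haveI : FiniteDimensional ℚ ↥(IntermediateField.adjoin ℚ ({β} : Set (AlgebraicClosure ℚ))) := IntermediateField.adjoin.finiteDimensional ((AlgebraicClosure.isAlgebraic ℚ).isAlgebraic β).isIntegral;
      haveI : NumberField ↥(IntermediateField.adjoin ℚ ({β} : Set (AlgebraicClosure ℚ))) := NumberField.mk;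
      ¬ 2 ∣ classNumber ↥(IntermediateField.adjoin ℚ ({β} : Set (AlgebraicClosure ℚ)))) := by
  haveI : FiniteDimensional ℚ ↥(IntermediateField.adjoin ℚ ({β} : Set (AlgebraicClosure ℚ))) := IntermediateField.adjoin.finiteDimensional ((AlgebraicClosure.isAlgebraic ℚ).isAlgebraic β).isIntegral
  haveI : NumberField ↥(IntermediateField.adjoin ℚ ({β} : Set (AlgebraicClosure ℚ))) := NumberField.mk
  exact CubicDisc4087.not_two_dvd_classNumber (finrank_cubicField_n4087bis hβ) (aeval_theta_n4087bis hβ)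

end Summit.BirchSwinnertonDyer.BirchSwinnertonDyer.Theorems.AlignedTransportAtTwoCubicSplitStratumSeedN4087bis

end
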